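import Summits.NavierStokesRegularity.NavierStokesRegularity.Theses.RellichScar
import Summits.NavierStokesRegularity.NavierStokesRegularity.Theorems.ScarRigidity.Negative.LogicAndLoadBearing
import Literature.Analysis.FluidPDE.TypeIAncientMild
import Literature.Analysis.FluidPDE.ParasiticSlabFlow
import Summits.NavierStokesRegularity.NavierStokesRegularity.Theorems.RellichScarScarRigidityLogConvexityODE
import HarnessLib

/-!
# `ScarRigidity` — line `finite-energy-log-convexity`, stub `stub_logConvexityBelowThreshold`:
# no extinction below the threshold (crux stmt-NavierStokesRegularity-11717)

Helper file 2 of S4 (`stub_logConvexityBelowThreshold`). From the real-variable lower bound of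
helper file 1 (`logConvexity_lowerBound`: on every interval of positivity `(t₀, T)`, `T ≤ 0`,
the energy `N` of the Agmon–Nirenberg frame with `2C² < 1` is bounded below on `[t₁, T)`) we
derive the **extinction theorem**

* `logConvexity_extinction` — if `N, b ≥ 0` are differentiable on `t < 0`, satisfy the energy
  inequality `N' ≥ -(2b + (4C/√(-t))√(bN))` and the frequency law `b'N - bN' ≤ (2C²/(-t)) bN`,
  and `N(t) → 0` as `t ↑ 0`, then `N ≡ 0` on `t < 0`:

if `N(t₀) > 0`, the supremum `T` of the times `s ≤ 0` with `N > 0` on `[t₀, s]` cannot be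
negative (the lower bound on `[t₁, T)` and continuity give `N(T) > 0`, and positivity is open),
so `N > 0` on `[t₀, 0)` and the lower bound on `[t₀/2, 0)` contradicts `N → 0`.

* `eq_of_energyPackage` — the shape in which S4 consumes it: an *energy package* for the pair
  `(V₁, V₂)` (two real functions `N, b` with the above properties and `N(t) = 0 ⇒ V₁(t) = V₂(t)`;
  for S4, `N(t) = ‖(V₁ - V₂)(t)‖²_{Ḣ⁻¹}` is the Coulomb energy and `b(t) = ‖(V₁ - V₂)(t)‖²_{L²}`)
  forces `V₁ = V₂` on `t < 0`.

References: S. Agmon, L. Nirenberg, Comm. Pure Appl. Math. 20 (1967) (log-convexity / lower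
bounds for solutions of abstract parabolic inequalities); H. Ogawa, Proc. AMS 16 (1965);
K. Miller, Arch. Rational Mech. Anal. 54 (1974) (sharpness of such thresholds).
-/

noncomputable section

open Set Filter Function MeasureTheory Metric TopologicalSpace
open scoped Topology ENNReal NNReal InnerProductSpace RealInnerProductSpace
open Literature.Analysis.FluidPDE
open Summit.NavierStokesRegularity.NavierStokesRegularity.Theses.RellichScar
open Summit.NavierStokesRegularity.NavierStokesRegularity.Theorems.ScarRigidity.Negative

set_option linter.dupNamespace false

namespace Summit.NavierStokesRegularity.NavierStokesRegularity.Theorems.RellichScarScarRigidity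

/-! ## No extinction below the threshold -/

/-- **Extinction is impossible below the threshold `2C² < 1`.** For `N, b ≥ 0` differentiable
on `t < 0` with `N' ≥ -(2b + (4C/√(-t))√(bN))`, `b'N - bN' ≤ (2C²/(-t)) bN` and `N(t) → 0` as
`t ↑ 0`: `N ≡ 0` on `t < 0` (continuity/supremum argument over `logConvexity_lowerBound`;
Agmon–Nirenberg 1967, Ogawa 1965). [folklore] -/
theorem logConvexity_extinction {C : ℝ} (hC : 0 < C) (hthr : 2 * C ^ 2 < 1)
    {N b N' b' : ℝ → ℝ}
    (hN : ∀ t < 0, HasDerivAt N (N' t) t) (hb : ∀ t < 0, HasDerivAt b (b' t) t)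
    (hN0 : ∀ t < 0, 0 ≤ N t) (hb0 : ∀ t < 0, 0 ≤ b t)
    (hlog : ∀ t < 0, -(2 * b t + 4 * C / Real.sqrt (-t) * Real.sqrt (b t * N t)) ≤ N' t)
    (hfreq : ∀ t < 0, b' t * N t - b t * N' t ≤ 2 * C ^ 2 / (-t) * (b t * N t))
    (hvan : Tendsto N (𝓝[<] 0) (𝓝 0)) : ∀ t < 0, N t = 0 := by
  by_contra hcon
  push Not at hcon
  obtain ⟨t₀, ht₀, hNt₀⟩ := hcon
  have hNt₀' : 0 < N t₀ := lt_of_le_of_ne (hN0 t₀ ht₀) (Ne.symm hNt₀)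
  have hcont : ∀ t < 0, ContinuousAt N t := fun t ht => (hN t ht).continuousAt
  -- the lower bound on any interval of positivity
  have hlb : ∀ s T t₁ : ℝ, T ≤ 0 → (∀ u ∈ Ioo s T, 0 < N u) → t₁ ∈ Ioo s T →
      ∃ m : ℝ, 0 < m ∧ ∀ u ∈ Ico t₁ T, m ≤ N u := by
    intro s T t₁ hT hpos ht₁
    have hneg : ∀ u ∈ Ioo s T, u < 0 := fun u hu => lt_of_lt_of_le hu.2 hT
    exact logConvexity_lowerBound hC hthr hT (fun u hu => hN u (hneg u hu))
      (fun u hu => hb u (hneg u hu)) hpos (fun u hu => hb0 u (hneg u hu))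
      (fun u hu => hlog u (hneg u hu)) (fun u hu => hfreq u (hneg u hu)) ht₁
  -- positivity is open
  have hnbhd : ∀ t < 0, 0 < N t → ∃ δ > 0, ∀ u, |u - t| < δ → 0 < N u := by
    intro t ht hpos
    obtain ⟨δ, hδ, hball⟩ := Metric.eventually_nhds_iff.1 ((hcont t ht).eventually (lt_mem_nhds hpos))
    exact ⟨δ, hδ, fun u hu => hball (by rwa [Real.dist_eq])⟩
  -- the maximal interval of positivity issued from `t₀`
  set A : Set ℝ := {s | s ∈ Icc t₀ 0 ∧ ∀ u ∈ Icc t₀ s, 0 < N u} with hA_def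
  have hsingle : ∀ u ∈ Icc t₀ t₀, 0 < N u := fun u hu => by
    rw [le_antisymm hu.2 hu.1]; exact hNt₀'
  have ht₀A : t₀ ∈ A := ⟨⟨le_rfl, ht₀.le⟩, hsingle⟩
  have hAbdd : BddAbove A := ⟨0, fun s hs => hs.1.2⟩
  have hAne : A.Nonempty := ⟨t₀, ht₀A⟩
  have hT0 : sSup A ≤ 0 := csSup_le hAne fun s hs => hs.1.2
  have ht₀T : t₀ ≤ sSup A := le_csSup hAbdd ht₀A
  have hposT : ∀ u ∈ Ico t₀ (sSup A), 0 < N u := by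
    intro u hu
    obtain ⟨s, hsA, hus⟩ := exists_lt_of_lt_csSup hAne hu.2
    exact hsA.2 u ⟨hu.1, hus.le⟩
  -- extension past a negative time up to which `N > 0`
  have hext : ∀ T' : ℝ, t₀ ≤ T' → T' < 0 → (∀ u ∈ Icc t₀ T', 0 < N u) → ∃ s ∈ A, T' < s := by
    intro T' h1 h2 h3
    obtain ⟨δ, hδ, hδpos⟩ := hnbhd T' h2 (h3 T' ⟨h1, le_rfl⟩)
    refine ⟨min (T' + δ / 2) 0, ⟨⟨le_min (by linarith) ht₀.le, min_le_right _ _⟩,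
      fun u hu => ?_⟩, lt_min (by linarith) h2⟩
    by_cases huT : u ≤ T'
    · exact h3 u ⟨hu.1, huT⟩
    · push Not at huT
      apply hδpos
      have : u ≤ T' + δ / 2 := hu.2.trans (min_le_left _ _)
      rw [abs_lt]
      constructor <;> linarith
  -- Step A: `t₀ < sSup A`.
  have ht₀T' : t₀ < sSup A := by
    obtain ⟨s, hsA, hs⟩ := hext t₀ le_rfl ht₀ hsingle
    exact lt_of_lt_of_le hs (le_csSup hAbdd hsA)
  -- Step B: `sSup A = 0`.
  have hT : sSup A = 0 := by
    by_contra hTne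
    have hTneg : sSup A < 0 := lt_of_le_of_ne hT0 hTne
    obtain ⟨m, hm, hmle⟩ := hlb t₀ (sSup A) ((t₀ + sSup A) / 2) hT0
      (fun u hu => hposT u ⟨hu.1.le, hu.2⟩) ⟨by linarith, by linarith⟩
    have hNT : m ≤ N (sSup A) := by
      have hc : Tendsto N (𝓝[<] (sSup A)) (𝓝 (N (sSup A))) :=
        (hcont _ hTneg).tendsto.mono_left nhdsWithin_le_nhds
      have hev : ∀ᶠ u in 𝓝[<] (sSup A), m ≤ N u := by
        filter_upwards [Ico_mem_nhdsLT (show (t₀ + sSup A) / 2 < sSup A by linarith)]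
          with u hu using hmle u hu
      exact ge_of_tendsto hc hev
    have hposT' : ∀ u ∈ Icc t₀ (sSup A), 0 < N u := by
      intro u hu
      rcases hu.2.lt_or_eq with h | h
      · exact hposT u ⟨hu.1, h⟩
      · rw [h]; exact hm.trans_le hNT
    obtain ⟨s, hsA, hs⟩ := hext (sSup A) ht₀T hTneg hposT'
    exact absurd (le_csSup hAbdd hsA) (not_le.2 hs)
  -- Step C: contradiction with the vanishing at `t = 0`.
  rw [hT] at hposT ht₀T'
  obtain ⟨m, hm, hmle⟩ := hlb t₀ 0 (t₀ / 2) le_rfl (fun u hu => hposT u ⟨hu.1.le, hu.2⟩)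
    ⟨by linarith, by linarith⟩
  have hev1 : ∀ᶠ u in 𝓝[<] (0 : ℝ), N u < m := hvan (gt_mem_nhds hm)
  have hev2 : ∀ᶠ u in 𝓝[<] (0 : ℝ), u ∈ Ico (t₀ / 2) 0 := Ico_mem_nhdsLT (by linarith)
  obtain ⟨u, hu1, hu2⟩ := (hev1.and hev2).exists
  exact absurd (hmle u hu2) (not_le.2 hu1)

/-- **S4 from an energy package.** If a pair of fields `V₁, V₂` carries an *energy package below
the threshold* — real functions `N, b ≥ 0`, differentiable on `t < 0`, with the energy
inequality, the frequency law at constant `C`, `2C² < 1`, `N(t) → 0` as `t ↑ 0`, and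
`N(t) = 0 ⇒ V₁(t, ·) = V₂(t, ·)` — then `V₁ = V₂` on `t < 0`. For S4 the package is the
Coulomb (`Ḣ⁻¹`) energy of `V₁ - V₂` and its `L²` norm. [folklore] -/
theorem eq_of_energyPackage {α β : Type*} {V₁ V₂ : ℝ → α → β} {C : ℝ} (hC : 0 < C)
    (hthr : 2 * C ^ 2 < 1) {N b N' b' : ℝ → ℝ}
    (hN : ∀ t < 0, HasDerivAt N (N' t) t) (hb : ∀ t < 0, HasDerivAt b (b' t) t)
    (hN0 : ∀ t < 0, 0 ≤ N t) (hb0 : ∀ t < 0, 0 ≤ b t)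
    (hlog : ∀ t < 0, -(2 * b t + 4 * C / Real.sqrt (-t) * Real.sqrt (b t * N t)) ≤ N' t)
    (hfreq : ∀ t < 0, b' t * N t - b t * N' t ≤ 2 * C ^ 2 / (-t) * (b t * N t))
    (hvan : Tendsto N (𝓝[<] 0) (𝓝 0)) (hker : ∀ t < 0, N t = 0 → ∀ x, V₁ t x = V₂ t x) :
    ∀ t < 0, ∀ x, V₁ t x = V₂ t x := fun t ht =>
  hker t ht (logConvexity_extinction hC hthr hN hb hN0 hb0 hlog hfreq hvan t ht)

/-! ## Registered sub-goal (helper stub of `stub_logConvexityBelowThreshold`) -/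

/-- **Registered helper stub `stub_logConvexityExtinction`** (crux stmt-NavierStokesRegularity-11717,
line `finite-energy-log-convexity`, helper of S4): no extinction below the threshold, as
registered. [folklore] -/
theorem stub_logConvexityExtinction :
    ∀ (C : ℝ) (N b N' b' : ℝ → ℝ), 0 < C → 2 * C ^ 2 < 1 →
      (∀ t < 0, HasDerivAt N (N' t) t) → (∀ t < 0, HasDerivAt b (b' t) t) →
      (∀ t < 0, 0 ≤ N t) → (∀ t < 0, 0 ≤ b t) →
      (∀ t < 0, -(2 * b t + 4 * C / Real.sqrt (-t) * Real.sqrt (b t * N t)) ≤ N' t) →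
      (∀ t < 0, b' t * N t - b t * N' t ≤ 2 * C ^ 2 / (-t) * (b t * N t)) →
      Filter.Tendsto N (nhdsWithin 0 (Set.Iio 0)) (nhds 0) → ∀ t < 0, N t = 0 :=
  fun _C _N _b _N' _b' hC hthr hN hb hN0 hb0 hlog hfreq hvan =>
    logConvexity_extinction hC hthr hN hb hN0 hb0 hlog hfreq hvan

end Summit.NavierStokesRegularity.NavierStokesRegularity.Theorems.RellichScarScarRigidity

end
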